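import Literature.NumberTheory.DiophantineGeometry.AbcValuationProduct
import Literature.Barriers.ABC.BakerMethodBoundsPlaceBoundsProofs
import Literature.Barriers.ABC.BakerMethodBoundsStewartTijdemanProofs
import HarnessLib

/-!
# Pasten's Lemma 15.2: `v₂(abc) ≪_ε rad(abc)^ε`, from `p`-adic place bounds for the primes of the
# triple (hence from the approximation bound)

A *proofs* file (theorems only: no definition, no named fact) — part II of the kernel proof of
`Literature.NumberTheory.DiophantineGeometry.pasten2024_thm_2_5` from Pasten's Theorem 16.4 (ii)
(assembled in `AbcValuationProductShimuraProofs.lean`). H. Pasten, *Shimura curves and the abc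
conjecture*, J. Number Theory **254** (2024) 214–335 = arXiv:1705.09251v4, §15.1 **Lemma 15.2**
(p. 47): "Let `ε > 0`. There is a constant `C'_ε > 1` such that for all triples `a, b, c` of coprime
positive integers with `a + b = c` we have `v₂(abc) < C'_ε · rad(abc)^ε`." Printed proof:
Stewart–Yu's `2`-adic estimate ([ABC3] = Stewart–Yu 2001, (21)–(23)) and "`log log(abc) ≪
log rad(abc)`" ([ABC1] = Stewart–Tijdeman), the case `ω(abc) = 2` by Mihăilescu.

PROVED here (`factorization_two_lt_of_placeBounds`; the core `factorization_two_lt_of_twoAdicPlaceBounds`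
uses the place bounds at `p = 2` only, plus any bound `log max{e, 2 log c} ≪_δ rad^δ`) from the two
`p`-ADIC PLACE BOUNDS of the tree's Stewart–Yu reconstruction — the binders `hpad` (p ∣ a) and `hpadc` (p ∣ c, `ab > 1`) of
`Literature.Barriers.ABC.BakerMethodBounds_of_placeBounds`, i.e. for some `K ≥ 1` and every abc
triple, `ν_p(a) log p < Θ_{bc} · (p/log p)(log p + Y)` for the primes `p ∣ a` and
`ν_p(c) log p < Θ_{ab} · (p/log p)(log p + Y)` for the primes `p ∣ c`, where
`Θ_{uv} = theta K u v 0 = K^{ω(uv)+1} ∏_{q ∣ uv} log q` (`theta_zero_eq`) and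
`Y = log max{e, 2 log c}`. These concern linear forms in `p`-adic logarithms of distinct rational
PRIMES only (threshold `N = 0`: no cofactor), so they are supplied (a) by `PastenApproximationBound K`
(`Pasten.padic_bound_a`, `Pasten.padic_bound_c`; Pasten, Invent. Math. 236 (2024), Thm 2.1 —
itself a theorem of the tree relative to Evertse–Győry's Thm 4.2.1 over `ℚ`,
`Dioph.pasten2024_thm_2_1`), whence `factorization_two_lt_of_approximationBound` and
`factorization_two_lt_of_evertseGyory`, and (b) by `p`-adic estimates of Yu-2007 quality for
rational primes (the texts `Y07Odd` / `Y07Two` of the route `PadicPrimesKummerThird` of summit ABC,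
through the cell's `placeBound_a_of_y07At` / `placeBound_c_of_y07At`, Summits side). Architecture
= the printed one in the tree's currency: at `p = 2` the place bounds (for `2 ∣ a`; on the swapped
triple for `2 ∣ b`; for `2 ∣ c`, the triple `(1,1,2)` aside) give
`v₂(x) · log 2 < Θ · (2/log 2)(log 2 + Y)`; the two absorptions `K^{ω(n)} ≪_δ rad(n)^δ`,
`∏_{q ∣ n} log q ≪_δ rad(n)^δ` (`prod_primeFactors_le_pow_mul_rpow`, the device of the printed
proof of Prop. 15.1: "`∏_{p ∣ m}(1 + log p) ≪_ε rad(m)^ε`") give `Θ ≪ rad^{2ε/3}`; and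
"`log log(abc) ≪ log rad(abc)`" is obtained WITHOUT any archimedean input, Stewart–Tijdeman style,
from the `p ∣ c` bounds summed over the primes of `c` (`log_lt_route_c_of_placeBounds`) and the
self-improvement `le_of_le_mul_log_max`: `log c ≤ κ_K rad(abc)^6`
(`exists_log_le_mul_pow_six_of_placeBound_c`), so `Y ≪_δ rad^δ`
(`exists_log_max_exp_le_mul_rpow_of_placeBound_c`). No Catalan case is needed (the place bounds
have no lower constraint on `p`). Trust base of `factorization_two_lt_of_evertseGyory`:
Evertse–Győry 4.2.1 alone; of `factorization_two_lt_of_placeBounds`: its two binders.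

## References

* [PastenShimura2024] H. Pasten, J. Number Theory 254 (2024) = arXiv:1705.09251v4 — §15.1,
  Proposition 15.1 (proof) and Lemma 15.2, p. 47.
* [Pasten2024] H. Pasten, Invent. Math. 236 (2024) 373–385 — Thm 2.1.
* [EvertseGyory2015] J.-H. Evertse, K. Győry, *Unit Equations in Diophantine Number Theory*,
  CUP 2015 — Thm 4.2.1 (p. 68).
-/

noncomputable section

open Finset Real

namespace Literature.NumberTheory.DiophantineGeometry

/-! ### Absorption of prime-by-prime factors into `rad^δ` -/

/-- **Absorption lemma.** If `0 ≤ g(p) ≤ p^δ` for the primes `p ≥ T` and `0 ≤ g(p) ≤ B` (`B ≥ 1`)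
for the primes `p < T`, then `∏_{p ∣ n} g(p) ≤ B^T · (∏_{p ∣ n} p)^δ` for every `n` (`δ ≥ 0`):
split the primes of `n` at `T`. This is the device behind "`∏_{p ∣ m}(1 + log p) ≪_ε rad(m)^ε`"
in the proof of Proposition 15.1 (p. 47) and behind `2^{ω(n)} ≪_δ rad(n)^δ`
(`exists_two_pow_card_primeFactors_le`). [cite: PastenShimura2024, Proposition 15.1 (proof, arXiv:1705.09251v4 p. 47)] -/
theorem prod_primeFactors_le_pow_mul_rpow {g : ℕ → ℝ} (hg0 : ∀ p, p.Prime → 0 ≤ g p)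
    {δ : ℝ} (hδ : 0 ≤ δ) {T : ℕ} (hT : ∀ p, p.Prime → T ≤ p → g p ≤ (p : ℝ) ^ δ)
    {B : ℝ} (hB1 : 1 ≤ B) (hB : ∀ p, p.Prime → p < T → g p ≤ B) (n : ℕ) :
    ∏ p ∈ n.primeFactors, g p ≤ B ^ T * (∏ p ∈ n.primeFactors, (p : ℝ)) ^ δ := by
  set P := n.primeFactors with hP
  have hprime : ∀ p ∈ P, p.Prime := fun p hp => Nat.prime_of_mem_primeFactors hp
  have hsplit := prod_filter_mul_prod_filter_not P (· < T) g
  have hS : (P.filter (· < T)).card ≤ T := by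
    calc (P.filter (· < T)).card ≤ (Finset.range T).card :=
          card_le_card fun p hp => by
            rw [mem_filter] at hp
            exact mem_range.2 hp.2
      _ = T := card_range T
  have hsmall : ∏ p ∈ P.filter (· < T), g p ≤ B ^ T := by
    calc ∏ p ∈ P.filter (· < T), g p ≤ ∏ _p ∈ P.filter (· < T), B :=
          prod_le_prod (fun p hp => hg0 p (hprime p (mem_filter.1 hp).1)) fun p hp =>
            hB p (hprime p (mem_filter.1 hp).1) (mem_filter.1 hp).2
      _ = B ^ (P.filter (· < T)).card := prod_const B
      _ ≤ B ^ T := pow_le_pow_right₀ hB1 hS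
  have hlarge : ∏ p ∈ P.filter (fun p => ¬ p < T), g p ≤ (∏ p ∈ P, (p : ℝ)) ^ δ := by
    rw [← Real.finsetProd_rpow _ _ (fun p _ => by positivity)]
    calc ∏ p ∈ P.filter (fun p => ¬ p < T), g p
        ≤ ∏ p ∈ P.filter (fun p => ¬ p < T), (p : ℝ) ^ δ :=
          prod_le_prod (fun p hp => hg0 p (hprime p (mem_filter.1 hp).1)) fun p hp => by
            rw [mem_filter, not_lt] at hp
            exact hT p (hprime p hp.1) hp.2
      _ ≤ ∏ p ∈ P, (p : ℝ) ^ δ :=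
          prod_le_prod_of_subset_of_one_le (filter_subset _ _) (fun _ _ => by positivity)
            fun p hp _ => Real.one_le_rpow (by exact_mod_cast (hprime p hp).one_le) hδ
  have h0small : 0 ≤ ∏ p ∈ P.filter (· < T), g p :=
    prod_nonneg fun p hp => hg0 p (hprime p (mem_filter.1 hp).1)
  have h0large : 0 ≤ ∏ p ∈ P.filter (fun p => ¬ p < T), g p :=
    prod_nonneg fun p hp => hg0 p (hprime p (mem_filter.1 hp).1)
  rw [← hsplit]
  exact mul_le_mul hsmall hlarge h0large (by positivity)

/-- **`K^{ω(n)} ≪_δ rad(n)^δ`**: for `K ≥ 1` and `δ > 0` there is `C ≥ 1` with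
`K^{ω(n)} ≤ C · (∏_{p ∣ n} p)^δ` for all `n` (primes `p ≥ K^{1/δ}` contribute `p^δ ≥ K` each).
The device absorbing the factor `C_ε^ν`, `ν^{2ν²}`-free part, of Proposition 15.1 / the `K^m` of the
approximation bound. [cite: PastenShimura2024, Proposition 15.1 (proof, arXiv:1705.09251v4 p. 47)] -/
theorem exists_pow_card_primeFactors_le_mul_rpow {K : ℝ} (hK : 1 ≤ K) {δ : ℝ} (hδ : 0 < δ) :
    ∃ C : ℝ, 1 ≤ C ∧ ∀ n : ℕ,
      K ^ n.primeFactors.card ≤ C * (∏ p ∈ n.primeFactors, (p : ℝ)) ^ δ := by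
  set T : ℕ := ⌈K ^ (1 / δ)⌉₊ with hTdef
  refine ⟨K ^ T, one_le_pow₀ hK, fun n => ?_⟩
  have h := prod_primeFactors_le_pow_mul_rpow (g := fun _ => K) (fun _ _ => zero_le_one.trans hK)
    hδ.le (T := T) (fun p _ hp => ?_) hK (fun _ _ _ => le_rfl) n
  · rwa [prod_const] at h
  · have h1 : K ^ (1 / δ) ≤ (p : ℝ) := (Nat.le_ceil _).trans (by exact_mod_cast hp)
    calc K = (K ^ (1 / δ)) ^ δ := by
          rw [← Real.rpow_mul (zero_le_one.trans hK), one_div_mul_cancel hδ.ne', Real.rpow_one]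
      _ ≤ (p : ℝ) ^ δ := Real.rpow_le_rpow (by positivity) h1 hδ.le

/-- **`∏_{p ∣ n} log p ≪_δ rad(n)^δ`**: for `δ > 0` there is `C ≥ 1` with
`∏_{p ∣ n} log p ≤ C · (∏_{p ∣ n} p)^δ` for all `n` (`log p ≤ p^δ` for `p ≥ (2/δ)^{2/δ}`, since
`log p ≤ (2/δ) p^{δ/2}`; the small primes contribute a constant). Print: "`∏_{p ∣ m}(1 + log p)
≪_ε rad(m)^ε` which has an implicit constant that only depends on `ε`" (p. 47).
[cite: PastenShimura2024, Proposition 15.1 (proof, arXiv:1705.09251v4 p. 47)] -/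
theorem exists_prod_log_primeFactors_le_mul_rpow {δ : ℝ} (hδ : 0 < δ) :
    ∃ C : ℝ, 1 ≤ C ∧ ∀ n : ℕ,
      ∏ p ∈ n.primeFactors, Real.log (p : ℝ) ≤ C * (∏ p ∈ n.primeFactors, (p : ℝ)) ^ δ := by
  set T : ℕ := ⌈(2 / δ) ^ (2 / δ)⌉₊ with hTdef
  set B : ℝ := max 1 (T : ℝ) with hBdef
  have hB1 : 1 ≤ B := le_max_left _ _
  refine ⟨B ^ T, one_le_pow₀ hB1, fun n => ?_⟩
  refine prod_primeFactors_le_pow_mul_rpow (g := fun p => Real.log (p : ℝ))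
    (fun p hp => Real.log_nonneg (by exact_mod_cast hp.one_le)) hδ.le (T := T)
    (fun p hp hTp => ?_) hB1 (fun p hp hpT => ?_) n
  · -- `p ≥ T`: `log p ≤ (2/δ) p^{δ/2} ≤ p^{δ/2} p^{δ/2} = p^δ`
    have hp0 : (0 : ℝ) ≤ p := by positivity
    have hδ2 : 0 < δ / 2 := by positivity
    have h1 : Real.log (p : ℝ) ≤ (p : ℝ) ^ (δ / 2) / (δ / 2) := Real.log_le_rpow_div hp0 hδ2
    have h2 : (2 / δ) ^ (2 / δ) ≤ (p : ℝ) := (Nat.le_ceil _).trans (by exact_mod_cast hTp)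
    have h3 : (2 : ℝ) / δ ≤ (p : ℝ) ^ (δ / 2) := by
      have h2δ : (0 : ℝ) ≤ 2 / δ := by positivity
      calc (2 : ℝ) / δ = ((2 / δ) ^ (2 / δ)) ^ (δ / 2) := by
            rw [← Real.rpow_mul h2δ, show (2 : ℝ) / δ * (δ / 2) = 1 by field_simp, Real.rpow_one]
        _ ≤ (p : ℝ) ^ (δ / 2) := Real.rpow_le_rpow (by positivity) h2 hδ2.le
    have h4 : (0 : ℝ) ≤ (p : ℝ) ^ (δ / 2) := by positivity
    calc Real.log (p : ℝ) ≤ (p : ℝ) ^ (δ / 2) / (δ / 2) := h1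
      _ = (2 / δ) * (p : ℝ) ^ (δ / 2) := by rw [div_div_eq_mul_div]; ring
      _ ≤ (p : ℝ) ^ (δ / 2) * (p : ℝ) ^ (δ / 2) := mul_le_mul_of_nonneg_right h3 h4
      _ = (p : ℝ) ^ δ := by rw [← Real.rpow_add (by exact_mod_cast hp.pos)]; ring_nf
  · -- `p < T`: `log p ≤ p ≤ T ≤ B`
    calc Real.log (p : ℝ) ≤ p := Real.log_le_self (by positivity)
      _ ≤ T := by exact_mod_cast hpT.le
      _ ≤ B := le_max_right _ _

/-! ### Lemma 15.2 (`v₂(abc) ≪_ε rad(abc)^ε`) from the approximation bound -/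

section Lemma152

open Literature.NumberTheory.DiophantineGeometry.Dioph (PastenApproximationBound)
open Literature.NumberTheory.DiophantineGeometry.Pasten (theta theta_nonneg padic_bound_a
  padic_bound_c one_le_log_max_exp prod_primeFactors_le_radical)
open Literature.Barriers.ABC (one_le_rad_real theta_zero_eq)

variable {K : ℝ}

/-- `Θ_{uv} = K^{ω(uv)+1} ∏_{p ∣ uv} log p ≤ K · C_K · C_L · rad(uvw)^{2δ}` — the two absorptions
applied to Pasten's `Θ` at threshold `0` (`theta_zero_eq`). [cite: PastenShimura2024, Lemma 15.2 (proof, arXiv:1705.09251v4 p. 47)] -/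
private theorem theta_zero_le_mul_rpow (hK : 1 ≤ K) {δ : ℝ} (hδ : 0 < δ) {CK CL : ℝ}
    (hCK : ∀ n : ℕ, K ^ n.primeFactors.card ≤ CK * (∏ p ∈ n.primeFactors, (p : ℝ)) ^ δ)
    (hCL1 : 0 ≤ CL)
    (hCL : ∀ n : ℕ, ∏ p ∈ n.primeFactors, Real.log (p : ℝ) ≤ CL * (∏ p ∈ n.primeFactors, (p : ℝ)) ^ δ)
    {u v w : ℕ} (hu : u ≠ 0) (hv : v ≠ 0) (hw : w ≠ 0) (huv : u.Coprime v) :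
    theta K u v 0 ≤
      K * CK * CL * ((UniqueFactorizationMonoid.radical (u * v * w) : ℕ) : ℝ) ^ (2 * δ) := by
  rw [theta_zero_eq K hu hv huv, pow_succ]
  set Ruv : ℝ := ∏ p ∈ (u * v).primeFactors, (p : ℝ) with hRuv_def
  set Rw : ℝ := ((UniqueFactorizationMonoid.radical (u * v * w) : ℕ) : ℝ)
  have hRuv1 : 1 ≤ Ruv := by
    have h : 0 < ∏ p ∈ (u * v).primeFactors, p :=
      prod_pos fun p hp => (Nat.prime_of_mem_primeFactors hp).pos
    rw [hRuv_def, ← Nat.cast_prod]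
    exact_mod_cast h
  have hRuv0 : 0 ≤ Ruv := zero_le_one.trans hRuv1
  have hRle : Ruv ≤ Rw := prod_primeFactors_le_radical hu hv hw
  have hK0 : 0 ≤ K := zero_le_one.trans hK
  have h1 : K ^ (u * v).primeFactors.card ≤ CK * Ruv ^ δ := hCK (u * v)
  have h2 : ∏ p ∈ (u * v).primeFactors, Real.log (p : ℝ) ≤ CL * Ruv ^ δ := hCL (u * v)
  have hlog0 : 0 ≤ ∏ p ∈ (u * v).primeFactors, Real.log (p : ℝ) :=
    prod_nonneg fun p hp => Real.log_nonneg (by exact_mod_cast (Nat.prime_of_mem_primeFactors hp).one_le)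
  have hCK0 : 0 ≤ CK * Ruv ^ δ := (pow_nonneg hK0 _).trans h1
  have hδ2 : Ruv ^ δ * Ruv ^ δ = Ruv ^ (2 * δ) := by
    rw [← Real.rpow_add (lt_of_lt_of_le one_pos hRuv1)]; ring_nf
  calc K ^ (u * v).primeFactors.card * K * ∏ p ∈ (u * v).primeFactors, Real.log (p : ℝ)
      ≤ (CK * Ruv ^ δ) * K * (CL * Ruv ^ δ) := by
        apply mul_le_mul (mul_le_mul_of_nonneg_right h1 hK0) h2 hlog0
        exact mul_nonneg hCK0 hK0
    _ = K * CK * CL * (Ruv ^ δ * Ruv ^ δ) := by ring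
    _ = K * CK * CL * Ruv ^ (2 * δ) := by rw [hδ2]
    _ ≤ K * CK * CL * Rw ^ (2 * δ) := by
        apply mul_le_mul_of_nonneg_left (Real.rpow_le_rpow hRuv0 hRle (by positivity))
        have hCK1 : 0 ≤ CK := by
          have := hCK 1
          simp at this
          exact zero_le_one.trans this
        exact mul_nonneg (mul_nonneg hK0 hCK1) hCL1

/-- **`Y ≪_δ rad^δ` from a polynomial bound.** If `log c ≤ κ' · rad(abc)^n` (`κ' ≥ 1`, `n ∈ ℕ`),
then `Y = log max{e, 2 log c} ≤ (log(e + 2κ') + n/δ) · rad(abc)^δ` for every `δ > 0` — the input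
"`log log(abc) ≪ log rad(abc)`" of the printed proof of Lemma 15.2 ("we know [ABC1]
`log log(abc) ≤ log(rad(abc)^{15}) + O(1)`"). [cite: PastenShimura2024, Lemma 15.2 (proof, arXiv:1705.09251v4 p. 47)] -/
theorem log_max_exp_le_mul_rpow_of_log_le_mul_pow {a b c : ℕ} {κ' δ : ℝ} {n : ℕ} (hκ' : 1 ≤ κ')
    (hδ : 0 < δ) (hc : Real.log c ≤ κ' * (rad a b c : ℝ) ^ n) :
    Real.log (max (Real.exp 1) (2 * Real.log c)) ≤
      (Real.log (Real.exp 1 + 2 * κ') + n / δ) * (rad a b c : ℝ) ^ δ := by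
  set R : ℝ := (rad a b c : ℝ) with hRdef
  have hR1 : 1 ≤ R := one_le_rad_real a b c
  have hR0 : 0 < R := lt_of_lt_of_le one_pos hR1
  have hRδ : 1 ≤ R ^ δ := Real.one_le_rpow hR1 hδ.le
  have he : 0 < Real.exp 1 := Real.exp_pos 1
  have hRn : 1 ≤ R ^ n := one_le_pow₀ hR1
  -- `max{e, 2 log c} ≤ (e + 2κ') R^n`
  have hmax : max (Real.exp 1) (2 * Real.log c) ≤ (Real.exp 1 + 2 * κ') * R ^ n := by
    refine max_le ?_ ?_
    · nlinarith
    · nlinarith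
  have hpos : 0 < max (Real.exp 1) (2 * Real.log c) := lt_max_of_lt_left he
  have hE1 : 1 ≤ Real.log (Real.exp 1 + 2 * κ') := by
    have h1 := Real.log_le_log he (show Real.exp 1 ≤ Real.exp 1 + 2 * κ' by linarith)
    rwa [Real.log_exp] at h1
  have hn0 : (0 : ℝ) ≤ n := Nat.cast_nonneg n
  calc Real.log (max (Real.exp 1) (2 * Real.log c))
      ≤ Real.log ((Real.exp 1 + 2 * κ') * R ^ n) := Real.log_le_log hpos hmax
    _ = Real.log (Real.exp 1 + 2 * κ') + n * Real.log R := by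
        rw [Real.log_mul (by positivity) (by positivity), Real.log_pow]
    _ ≤ Real.log (Real.exp 1 + 2 * κ') + n * (R ^ δ / δ) := by
        have := mul_le_mul_of_nonneg_left (Real.log_le_rpow_div hR0.le hδ) hn0
        linarith
    _ ≤ (Real.log (Real.exp 1 + 2 * κ') + n / δ) * R ^ δ := by
        rw [add_mul]
        have h1 : Real.log (Real.exp 1 + 2 * κ') ≤ Real.log (Real.exp 1 + 2 * κ') * R ^ δ :=
          le_mul_of_one_le_right (by linarith) hRδ
        have h2 : n * (R ^ δ / δ) = n / δ * R ^ δ := by ring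
        linarith

/-- **`log c ≪_K rad(abc)^6` from the `p ∣ c` place bounds alone** (no archimedean input): summing
`ν_p(c) log p < Θ_{ab} (p/log p)(log p + Y)` over the primes of `c` gives
`log c < Θ_{ab} · Y · (1 + 3 ∑_{p ∣ c} p)` (`log_lt_route_c_of_placeBounds`), where
`Θ_{ab} ≤ K C_K C_L rad²` (the two absorptions with `δ = 1`) and `∑_{p ∣ c} p ≤ rad(c) ≤ rad(abc)`,
so `log c ≤ M · log max{e, 2 log c}` with `M = 4 K C_K C_L rad³`, whence `log c ≤ 2M log(4M) ≤ 8M²`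
(`le_of_le_mul_log_max`). This is the crude Stewart–Tijdeman step "`log log(abc) ≪ log rad(abc)`"
([ABC1]) of the printed proof, with exponent `6` instead of `15`. [cite: PastenShimura2024, Lemma 15.2 (proof, arXiv:1705.09251v4 p. 47)] -/
theorem exists_log_le_mul_pow_six_of_placeBound_c (hK : 1 ≤ K)
    (hpadc : ∀ {a b c : ℕ}, IsABCTriple a b c → 1 < a * b → ∀ {p : ℕ}, p.Prime → p ∣ c →
      (c.factorization p : ℝ) * Real.log p < theta K a b 0 *
        ((p / Real.log p) * (Real.log p + Real.log (max (Real.exp 1) (2 * Real.log c))))) :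
    ∃ κ : ℝ, 1 ≤ κ ∧ ∀ a b c : ℕ, IsABCTriple a b c → Real.log c ≤ κ * (rad a b c : ℝ) ^ 6 := by
  obtain ⟨CK, hCK1, hCK⟩ := exists_pow_card_primeFactors_le_mul_rpow hK one_pos
  obtain ⟨CL, hCL1, hCL⟩ := exists_prod_log_primeFactors_le_mul_rpow one_pos
  have hK0 : 0 ≤ K := zero_le_one.trans hK
  have hΘ₁1 : 1 ≤ K * CK * CL :=
    one_le_mul_of_one_le_of_one_le (one_le_mul_of_one_le_of_one_le hK hCK1) hCL1
  refine ⟨128 * (K * CK * CL) ^ 2, by nlinarith, fun a b c h => ?_⟩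
  obtain ⟨ha, hb, habc, hcop⟩ := id h
  have hc : 0 < c := by omega
  set R : ℝ := (rad a b c : ℝ) with hRdef
  have hR1 : 1 ≤ R := one_le_rad_real a b c
  have hR0 : 0 < R := lt_of_lt_of_le one_pos hR1
  have hR6 : 1 ≤ R ^ 6 := one_le_pow₀ hR1
  by_cases hab1 : 1 < a * b
  · -- `M = 4 K C_K C_L R³`
    set M : ℝ := 4 * (K * CK * CL) * R ^ 3 with hMdef
    have hM1 : 1 ≤ M := by
      have : 1 ≤ (K * CK * CL) * R ^ 3 := one_le_mul_of_one_le_of_one_le hΘ₁1 (one_le_pow₀ hR1)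
      rw [hMdef]; linarith
    -- `Θ_{ab} ≤ K C_K C_L R²`
    have hΘ : theta K a b 0 ≤ K * CK * CL * R ^ 2 := by
      have h1 := theta_zero_le_mul_rpow hK one_pos hCK (zero_le_one.trans hCL1) hCL ha.ne' hb.ne'
        hc.ne' hcop
      have h2 : ((UniqueFactorizationMonoid.radical (a * b * c) : ℕ) : ℝ) ^ (2 * (1 : ℝ)) = R ^ 2 := by
        rw [hRdef, rad_def, mul_one, Real.rpow_two]
      rwa [h2] at h1
    -- `∑_{p ∣ c} p ≤ R`
    have hsum : ∑ p ∈ c.primeFactors, (p : ℝ) ≤ R := by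
      have h1 : ((∑ p ∈ c.primeFactors, p : ℕ) : ℝ) ≤ ((∏ p ∈ c.primeFactors, p : ℕ) : ℝ) := by
        exact_mod_cast Literature.Barriers.ABC.sum_le_prod_of_two_le fun p hp =>
          (Nat.prime_of_mem_primeFactors hp).two_le
      have h2 := prod_primeFactors_le_radical hc.ne' one_ne_zero (w := a * b) (by positivity)
      rw [mul_one, show c * (a * b) = a * b * c by ring] at h2
      rw [hRdef, rad_def]
      push_cast at h1
      exact h1.trans h2
    have hroute := Literature.Barriers.ABC.log_lt_route_c_of_placeBounds hK h
      (fun hp hpc => hpadc h hab1 hp hpc)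
    have hY1 : 1 ≤ Real.log (max (Real.exp 1) (2 * Real.log c)) := one_le_log_max_exp _
    have hΘ0 : 0 ≤ theta K a b 0 := theta_nonneg hK0 a b 0
    have h13 : 1 + 3 * ∑ p ∈ c.primeFactors, (p : ℝ) ≤ 4 * R := by linarith
    have hlogc : Real.log c ≤ M * Real.log (max (Real.exp 1) (2 * Real.log c)) := by
      refine hroute.le.trans ?_
      calc theta K a b 0 * Real.log (max (Real.exp 1) (2 * Real.log c)) *
            (1 + 3 * ∑ p ∈ c.primeFactors, (p : ℝ))
          ≤ (K * CK * CL * R ^ 2) * Real.log (max (Real.exp 1) (2 * Real.log c)) * (4 * R) := by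
            apply mul_le_mul (mul_le_mul_of_nonneg_right hΘ (by linarith)) h13 (by positivity)
            exact mul_nonneg (by positivity) (by linarith)
        _ = M * Real.log (max (Real.exp 1) (2 * Real.log c)) := by rw [hMdef]; ring
    have hself := Literature.Barriers.ABC.le_of_le_mul_log_max hM1 hlogc
    -- `2M log(4M) ≤ 8M² = 128 (K C_K C_L)² R⁶`
    have hM0 : 0 < M := by linarith
    have hlog4M : Real.log (4 * M) ≤ 4 * M := Real.log_le_self (by positivity)
    calc Real.log c ≤ 2 * M * Real.log (4 * M) := hself
      _ ≤ 2 * M * (4 * M) := mul_le_mul_of_nonneg_left hlog4M (by positivity)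
      _ = 128 * (K * CK * CL) ^ 2 * R ^ 6 := by rw [hMdef]; ring
  · -- `a = b = 1`, `c = 2`
    have hab : a * b = 1 := by
      have : 1 ≤ a * b := Nat.one_le_iff_ne_zero.mpr (by positivity)
      omega
    obtain ⟨rfl, rfl⟩ := mul_eq_one.mp hab
    have hc2 : c = 2 := by omega
    subst hc2
    have hl2 : Real.log ((2 : ℕ) : ℝ) ≤ 1 := by
      have := Real.log_two_lt_d9; push_cast; linarith
    calc Real.log ((2 : ℕ) : ℝ) ≤ 1 := hl2
      _ ≤ 128 * (K * CK * CL) ^ 2 := by nlinarith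
      _ ≤ 128 * (K * CK * CL) ^ 2 * R ^ 6 := le_mul_of_one_le_right (by positivity) hR6

/-- **`Y = log max{e, 2 log c} ≪_δ rad(abc)^δ` from the `p ∣ c` place bounds**: for every `δ > 0`
there is `Y₀ ≥ 1` with `log max{e, 2 log c} ≤ Y₀ · rad(abc)^δ` for all abc triples — the input
"`log log(abc) ≪ log rad(abc)`" ([ABC1]) of the printed proofs of Proposition 15.1 and Lemma 15.2,
here from `exists_log_le_mul_pow_six_of_placeBound_c`. [cite: PastenShimura2024, Lemma 15.2 (proof, arXiv:1705.09251v4 p. 47)] -/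
theorem exists_log_max_exp_le_mul_rpow_of_placeBound_c (hK : 1 ≤ K)
    (hpadc : ∀ {a b c : ℕ}, IsABCTriple a b c → 1 < a * b → ∀ {p : ℕ}, p.Prime → p ∣ c →
      (c.factorization p : ℝ) * Real.log p < theta K a b 0 *
        ((p / Real.log p) * (Real.log p + Real.log (max (Real.exp 1) (2 * Real.log c)))))
    {δ : ℝ} (hδ : 0 < δ) :
    ∃ Y₀ : ℝ, 1 ≤ Y₀ ∧ ∀ a b c : ℕ, IsABCTriple a b c →
      Real.log (max (Real.exp 1) (2 * Real.log c)) ≤ Y₀ * (rad a b c : ℝ) ^ δ := by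
  obtain ⟨κ, hκ1, hκ⟩ := exists_log_le_mul_pow_six_of_placeBound_c hK hpadc
  refine ⟨Real.log (Real.exp 1 + 2 * κ) + (6 : ℕ) / δ, ?_, fun a b c h =>
    log_max_exp_le_mul_rpow_of_log_le_mul_pow hκ1 hδ (hκ a b c h)⟩
  have h1 := Real.log_le_log (Real.exp_pos 1) (show Real.exp 1 ≤ Real.exp 1 + 2 * κ by linarith)
  rw [Real.log_exp] at h1
  have h2 : (0 : ℝ) ≤ (6 : ℕ) / δ := by positivity
  linarith

/-- From a `2`-adic place bound `v · log 2 < Θ · (2/log 2)(log 2 + Y)` with `Θ ≤ Θ₁ R^{2δ}` and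
`Y ≤ Y₀ R^δ` (`R ≥ 1`): `v < Θ₁ · (2/(log 2)²) · (log 2 + Y₀) · R^{3δ}`. [cite: PastenShimura2024, Lemma 15.2 (proof, arXiv:1705.09251v4 p. 47)] -/
private theorem lt_of_two_adic_placeBound {v Θ Θ₁ Y Y₀ R δ : ℝ} (hR : 1 ≤ R) (hΘ0 : 0 ≤ Θ)
    (hΘ : Θ ≤ Θ₁ * R ^ (2 * δ)) (hY0 : 0 ≤ Y) (hY : Y ≤ Y₀ * R ^ δ) (hδ : 0 ≤ δ)
    (h : v * Real.log 2 < Θ * ((2 / Real.log 2) * (Real.log 2 + Y))) :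
    v < Θ₁ * (2 / Real.log 2 ^ 2) * (Real.log 2 + Y₀) * R ^ (3 * δ) := by
  have hl2 : 0 < Real.log 2 := Real.log_pos (by norm_num)
  have hR0 : 0 < R := lt_of_lt_of_le one_pos hR
  have hRδ : 1 ≤ R ^ δ := Real.one_le_rpow hR hδ
  have hΘ₁0 : 0 ≤ Θ₁ * R ^ (2 * δ) := hΘ0.trans hΘ
  have hsum : Real.log 2 + Y ≤ (Real.log 2 + Y₀) * R ^ δ := by
    rw [add_mul]
    have : Real.log 2 ≤ Real.log 2 * R ^ δ := le_mul_of_one_le_right hl2.le hRδ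
    linarith
  have h1 : Θ * ((2 / Real.log 2) * (Real.log 2 + Y)) ≤
      (Θ₁ * R ^ (2 * δ)) * ((2 / Real.log 2) * ((Real.log 2 + Y₀) * R ^ δ)) := by
    apply mul_le_mul hΘ (mul_le_mul_of_nonneg_left hsum (by positivity)) (by positivity) hΘ₁0
  have h3δ : R ^ (2 * δ) * R ^ δ = R ^ (3 * δ) := by
    rw [← Real.rpow_add hR0]; ring_nf
  have h2 : v * Real.log 2 <
      (Θ₁ * (2 / Real.log 2 ^ 2) * (Real.log 2 + Y₀) * R ^ (3 * δ)) * Real.log 2 := by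
    calc v * Real.log 2 < Θ * ((2 / Real.log 2) * (Real.log 2 + Y)) := h
      _ ≤ (Θ₁ * R ^ (2 * δ)) * ((2 / Real.log 2) * ((Real.log 2 + Y₀) * R ^ δ)) := h1
      _ = (Θ₁ * (2 / Real.log 2 ^ 2) * (Real.log 2 + Y₀) * (R ^ (2 * δ) * R ^ δ)) * Real.log 2 := by
          field_simp
      _ = (Θ₁ * (2 / Real.log 2 ^ 2) * (Real.log 2 + Y₀) * R ^ (3 * δ)) * Real.log 2 := by
          rw [h3δ]
  exact lt_of_mul_lt_mul_right h2 hl2.le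

/-- **Pasten, Lemma 15.2, from the `2`-adic place bounds and `log log c ≪ log rad`.** Printed
statement (arXiv:1705.09251v4 §15.1 p. 47): "Let `ε > 0`. There is a constant `C'_ε > 1` such that
for all triples `a, b, c` of coprime positive integers with `a + b = c` we have
`v₂(abc) < C'_ε · rad(abc)^ε`." Printed proof: Stewart–Yu's `2`-adic estimate [ABC3, (21)–(23)]
together with "`log log(abc) ≪ log rad(abc)`" [ABC1]. Here, for any `K ≥ 1`: the two place bounds
AT `p = 2` ONLY — `hpad2` (for `2 ∣ a`; used also on the swapped triple for `2 ∣ b`) and `hpadc2`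
(for `2 ∣ c`, `ab > 1`), i.e. the binders of `Literature.Barriers.ABC.BakerMethodBounds_of_placeBounds`
at the prime `2` (linear forms in `2`-adic logarithms of odd rational PRIMES: the text `Y07Two` of
summit ABC supplies them through the cell's `placeBound_a_of_y07At` / `placeBound_c_of_y07At`) — and
a bound `Y = log max{e, 2 log c} ≤ Y₀(δ) rad^δ` for every `δ > 0` (binder `hY`; from any
polynomial bound `log c ≪ rad^n`, `exists_log_max_exp_le_mul_rpow_of_log_le_mul_pow`; from the
`p ∣ c` place bounds, `exists_log_max_exp_le_mul_rpow_of_placeBound_c`). They give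
`v₂(x) log 2 < Θ · (2/log 2)(log 2 + Y)` with `Θ = K^{ω+1} ∏ log q ≪ rad^{2ε/3}` (the two
absorptions) and `Y ≪ rad^{ε/3}`; no Catalan case and no archimedean estimate is needed.
[cite: PastenShimura2024, Lemma 15.2 (§15.1, arXiv:1705.09251v4 p. 47)] -/
theorem factorization_two_lt_of_twoAdicPlaceBounds (hK : 1 ≤ K)
    (hpad2 : ∀ {a b c : ℕ}, IsABCTriple a b c → 2 ∣ a →
      (a.factorization 2 : ℝ) * Real.log 2 < theta K b c 0 *
        ((2 / Real.log 2) * (Real.log 2 + Real.log (max (Real.exp 1) (2 * Real.log c)))))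
    (hpadc2 : ∀ {a b c : ℕ}, IsABCTriple a b c → 1 < a * b → 2 ∣ c →
      (c.factorization 2 : ℝ) * Real.log 2 < theta K a b 0 *
        ((2 / Real.log 2) * (Real.log 2 + Real.log (max (Real.exp 1) (2 * Real.log c)))))
    (hY : ∀ δ : ℝ, 0 < δ → ∃ Y₀ : ℝ, 1 ≤ Y₀ ∧ ∀ a b c : ℕ, IsABCTriple a b c →
      Real.log (max (Real.exp 1) (2 * Real.log c)) ≤ Y₀ * (rad a b c : ℝ) ^ δ)
    (ε : ℝ) (hε : 0 < ε) :
    ∃ C : ℝ, 1 < C ∧ ∀ a b c : ℕ, IsABCTriple a b c →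
      (((a * b * c).factorization 2 : ℕ) : ℝ) < C * (rad a b c : ℝ) ^ ε := by
  set δ : ℝ := ε / 3 with hδdef
  have hδ : 0 < δ := by positivity
  have h3δ : 3 * δ = ε := by rw [hδdef]; ring
  obtain ⟨CK, hCK1, hCK⟩ := exists_pow_card_primeFactors_le_mul_rpow hK hδ
  obtain ⟨CL, hCL1, hCL⟩ := exists_prod_log_primeFactors_le_mul_rpow hδ
  obtain ⟨Y₀, hY₀1, hY₀⟩ := hY δ hδ
  set Θ₁ : ℝ := K * CK * CL with hΘ₁def
  set C₀ : ℝ := Θ₁ * (2 / Real.log 2 ^ 2) * (Real.log 2 + Y₀) with hC₀def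
  have hl2 : 0 < Real.log 2 := Real.log_pos (by norm_num)
  have hl2' : Real.log 2 < 1 := by
    have := Real.log_two_lt_d9; linarith
  have hΘ₁1 : 1 ≤ Θ₁ := by
    have := one_le_mul_of_one_le_of_one_le (one_le_mul_of_one_le_of_one_le hK hCK1) hCL1
    exact this
  have hC₀1 : 1 < C₀ := by
    have h1 : 1 < 2 / Real.log 2 ^ 2 := by
      rw [lt_div_iff₀ (by positivity)]; nlinarith
    have h2 : 1 < Real.log 2 + Y₀ := by linarith
    calc (1 : ℝ) = 1 * 1 * 1 := by ring
      _ < Θ₁ * (2 / Real.log 2 ^ 2) * (Real.log 2 + Y₀) := by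
          apply mul_lt_mul' (mul_le_mul hΘ₁1 h1.le zero_le_one (by linarith)) h2 zero_le_one
          positivity
  refine ⟨3 * C₀, by linarith, fun a b c h => ?_⟩
  obtain ⟨ha, hb, habc, hcop⟩ := id h
  have hc : 0 < c := by omega
  set R : ℝ := (rad a b c : ℝ) with hRdef
  have hR1 : 1 ≤ R := one_le_rad_real a b c
  have hRε : 1 ≤ R ^ (3 * δ) := Real.one_le_rpow hR1 (by positivity)
  -- `Y ≪ R^δ`
  have hY0 : 0 ≤ Real.log (max (Real.exp 1) (2 * Real.log c)) :=
    zero_le_one.trans (one_le_log_max_exp _)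
  have hY : Real.log (max (Real.exp 1) (2 * Real.log c)) ≤ Y₀ * R ^ δ := hY₀ a b c h
  -- `Θ ≪ R^{2δ}` on the three routes
  have hrad : ∀ u v w : ℕ, u * v * w = a * b * c →
      ((UniqueFactorizationMonoid.radical (u * v * w) : ℕ) : ℝ) = R := by
    intro u v w huvw; rw [hRdef, rad_def, huvw]
  have hbc : b.Coprime c := by rw [← habc]; exact Nat.coprime_add_self_right.mpr hcop.symm
  have hac : a.Coprime c := by rw [← habc]; exact Nat.coprime_self_add_right.mpr hcop
  have hΘbc : theta K b c 0 ≤ Θ₁ * R ^ (2 * δ) := by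
    have := theta_zero_le_mul_rpow hK hδ hCK (zero_le_one.trans hCL1) hCL hb.ne' hc.ne' ha.ne' hbc
    rwa [hrad b c a (by ring)] at this
  have hΘac : theta K a c 0 ≤ Θ₁ * R ^ (2 * δ) := by
    have := theta_zero_le_mul_rpow hK hδ hCK (zero_le_one.trans hCL1) hCL ha.ne' hc.ne' hb.ne' hac
    rwa [hrad a c b (by ring)] at this
  have hΘab : theta K a b 0 ≤ Θ₁ * R ^ (2 * δ) := by
    have := theta_zero_le_mul_rpow hK hδ hCK (zero_le_one.trans hCL1) hCL ha.ne' hb.ne' hc.ne' hcop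
    rwa [hrad a b c rfl] at this
  have hK0 : 0 ≤ K := zero_le_one.trans hK
  have hpos : 0 < C₀ * R ^ (3 * δ) := by positivity
  -- the three members
  have hfa : ((a.factorization 2 : ℕ) : ℝ) < C₀ * R ^ (3 * δ) := by
    by_cases h2a : 2 ∣ a
    · exact lt_of_two_adic_placeBound hR1 (theta_nonneg hK0 b c 0) hΘbc hY0 hY hδ.le
        (hpad2 h h2a)
    · rw [Nat.factorization_eq_zero_of_not_dvd h2a, Nat.cast_zero]; exact hpos
  have hfb : ((b.factorization 2 : ℕ) : ℝ) < C₀ * R ^ (3 * δ) := by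
    by_cases h2b : 2 ∣ b
    · exact lt_of_two_adic_placeBound hR1 (theta_nonneg hK0 a c 0) hΘac hY0 hY hδ.le
        (hpad2 h.swap h2b)
    · rw [Nat.factorization_eq_zero_of_not_dvd h2b, Nat.cast_zero]; exact hpos
  have hfc : ((c.factorization 2 : ℕ) : ℝ) < C₀ * R ^ (3 * δ) := by
    by_cases hab1 : 1 < a * b
    · by_cases h2c : 2 ∣ c
      · exact lt_of_two_adic_placeBound hR1 (theta_nonneg hK0 a b 0) hΘab hY0 hY hδ.le
          (hpadc2 h hab1 h2c)
      · rw [Nat.factorization_eq_zero_of_not_dvd h2c, Nat.cast_zero]; exact hpos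
    · -- `a = b = 1`, `c = 2`
      have hab : a * b = 1 := by
        have : 1 ≤ a * b := Nat.one_le_iff_ne_zero.mpr (by positivity)
        omega
      obtain ⟨rfl, rfl⟩ := mul_eq_one.mp hab
      have hc2 : c = 2 := by omega
      subst hc2
      rw [Nat.Prime.factorization_self Nat.prime_two, Nat.cast_one]
      calc (1 : ℝ) < C₀ := hC₀1
        _ ≤ C₀ * R ^ (3 * δ) := le_mul_of_one_le_right (by linarith) hRε
  -- sum
  have habc0 : a * b ≠ 0 := by positivity
  have hsum : (a * b * c).factorization 2 =
      a.factorization 2 + b.factorization 2 + c.factorization 2 := by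
    rw [Nat.factorization_mul habc0 hc.ne', Nat.factorization_mul ha.ne' hb.ne']
    rfl
  rw [hsum, ← h3δ]
  push_cast
  linarith

/-- **`Y ≪_δ rad^δ` from a polynomial bound, packaged**: if `log c ≤ κ rad(abc)^n` for all
abc triples (`κ ≥ 1`), then for every `δ > 0`, `log max{e, 2 log c} ≤ Y₀ rad^δ` with
`Y₀ = log(e + 2κ) + n/δ ≥ 1` — the binder `hY` of `factorization_two_lt_of_twoAdicPlaceBounds`.
[cite: PastenShimura2024, Lemma 15.2 (proof, arXiv:1705.09251v4 p. 47)] -/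
theorem exists_log_max_exp_le_mul_rpow_of_log_le_mul_pow {κ : ℝ} {n : ℕ} (hκ : 1 ≤ κ)
    (hlog : ∀ a b c : ℕ, IsABCTriple a b c → Real.log c ≤ κ * (rad a b c : ℝ) ^ n)
    (δ : ℝ) (hδ : 0 < δ) :
    ∃ Y₀ : ℝ, 1 ≤ Y₀ ∧ ∀ a b c : ℕ, IsABCTriple a b c →
      Real.log (max (Real.exp 1) (2 * Real.log c)) ≤ Y₀ * (rad a b c : ℝ) ^ δ := by
  refine ⟨Real.log (Real.exp 1 + 2 * κ) + n / δ, ?_, fun a b c h =>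
    log_max_exp_le_mul_rpow_of_log_le_mul_pow hκ hδ (hlog a b c h)⟩
  have h1 := Real.log_le_log (Real.exp_pos 1) (show Real.exp 1 ≤ Real.exp 1 + 2 * κ by linarith)
  rw [Real.log_exp] at h1
  have h2 : (0 : ℝ) ≤ n / δ := by positivity
  linarith

/-- **Pasten, Lemma 15.2, from the `p`-adic place bounds** (the two binders `hpad` (p ∣ a) /
`hpadc` (p ∣ c, `ab > 1`) of `Literature.Barriers.ABC.BakerMethodBounds_of_placeBounds` for some
`K ≥ 1`): the `2`-adic bounds are their case `p = 2`, and `log log c ≪ log rad` comes from the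
`p ∣ c` bounds (`exists_log_max_exp_le_mul_rpow_of_placeBound_c`), with no archimedean input.
[cite: PastenShimura2024, Lemma 15.2 (§15.1, arXiv:1705.09251v4 p. 47)] -/
theorem factorization_two_lt_of_placeBounds (hK : 1 ≤ K)
    (hpad : ∀ {a b c : ℕ}, IsABCTriple a b c → ∀ {p : ℕ}, p.Prime → p ∣ a →
      (a.factorization p : ℝ) * Real.log p < theta K b c 0 *
        ((p / Real.log p) * (Real.log p + Real.log (max (Real.exp 1) (2 * Real.log c)))))
    (hpadc : ∀ {a b c : ℕ}, IsABCTriple a b c → 1 < a * b → ∀ {p : ℕ}, p.Prime → p ∣ c →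
      (c.factorization p : ℝ) * Real.log p < theta K a b 0 *
        ((p / Real.log p) * (Real.log p + Real.log (max (Real.exp 1) (2 * Real.log c)))))
    (ε : ℝ) (hε : 0 < ε) :
    ∃ C : ℝ, 1 < C ∧ ∀ a b c : ℕ, IsABCTriple a b c →
      (((a * b * c).factorization 2 : ℕ) : ℝ) < C * (rad a b c : ℝ) ^ ε :=
  factorization_two_lt_of_twoAdicPlaceBounds hK (fun h h2a => hpad h Nat.prime_two h2a)
    (fun h h1 h2c => hpadc h h1 Nat.prime_two h2c)
    (fun _ hδ => exists_log_max_exp_le_mul_rpow_of_placeBound_c hK hpadc hδ) ε hε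

/-- **Pasten, Lemma 15.2, from the approximation bound**: for any `K ≥ 1` with
`PastenApproximationBound K` (Pasten, Invent. Math. 2024, Thm 2.1 — PROVED in the tree from
Evertse–Győry 4.2.1, `pasten2024_thm_2_1`) the two place bounds are the tree's `Pasten.padic_bound_a`
and `Pasten.padic_bound_c` at threshold `N = 0`. [cite: PastenShimura2024, Lemma 15.2 (§15.1, arXiv:1705.09251v4 p. 47)] -/
theorem factorization_two_lt_of_approximationBound (hK : 1 ≤ K) (hP : PastenApproximationBound K)
    (ε : ℝ) (hε : 0 < ε) :
    ∃ C : ℝ, 1 < C ∧ ∀ a b c : ℕ, IsABCTriple a b c →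
      (((a * b * c).factorization 2 : ℕ) : ℝ) < C * (rad a b c : ℝ) ^ ε :=
  factorization_two_lt_of_placeBounds hK (fun h _ hp hpa => padic_bound_a hK hP h 0 hp hpa)
    (fun h h1 _ hp hpc => padic_bound_c hK hP h h1 0 hp hpc) ε hε

/-- **Lemma 15.2 with the trust base of the tree**: from Evertse–Győry's Theorem 4.2.1 over `ℚ`
(`evertseGyory_thm_4_2_1_rat`, Matveev + Yu) through `pasten2024_thm_2_1` (`K = pastenK`).
[cite: PastenShimura2024, Lemma 15.2 (§15.1, arXiv:1705.09251v4 p. 47)] [cite: EvertseGyory2015, Theorem 4.2.1 (p. 68)] -/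
theorem factorization_two_lt_of_evertseGyory (hEG : Dioph.evertseGyory_thm_4_2_1_rat) (ε : ℝ)
    (hε : 0 < ε) :
    ∃ C : ℝ, 1 < C ∧ ∀ a b c : ℕ, IsABCTriple a b c →
      (((a * b * c).factorization 2 : ℕ) : ℝ) < C * (rad a b c : ℝ) ^ ε :=
  factorization_two_lt_of_approximationBound Dioph.one_le_pastenK (Dioph.pasten2024_thm_2_1 hEG) ε hε

end Lemma152

end Literature.NumberTheory.DiophantineGeometry

end
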